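import Summits.CriticalPhenomena.PercolationContinuityZ3.Theorems.PercNearOneGluingNoHeavyLowerTailNineTypeCubeCount
import Summits.CriticalPhenomena.PercolationContinuityZ3.Theorems.PercNearOneGluingNoHeavyLowerTailNineTypeCellCount
import Summits.CriticalPhenomena.PercolationContinuityZ3.Theorems.PercNearOneGluingNoHeavyLowerTailQ44bPackingsAllN

/-!
# Nine-type kernels without types 1, 2 are good — `Q44b` minus the AC-light types, for all `n`

Support file for crux `stmt-CriticalPhenomena-4575` (`Q44b`, GF(2)-rank line of `prim-bnk-1`), seat `prim-bnk-1` gen 19;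
memo `run/shared/lean/prim/prim-l12/FROM-prim-bnk-1-gen19-HALL-GRAM-ASSEMBLY.md` §13.

`TwoCopyMono.goodKernel_kerS_no12`: for every `S ⊆ {3,…,9}` the nine-type kernel `kerS S` is a good kernel (the `{5,7} × {8,9}`
clash together with all of the types 3, 4, 6); combinatorial input `NineType.card_le_of_no_12` (cube certificate).
Law-level consequence for every finite weighted graph (`q44b_pack_no12`; seven of the nine (heavy, light) products of `Q44b`,
i.e. everything except the two products with heavy cell `ab|cy`):
`P(ab|c|y)·[P(ac|by)+P(ay|bc)+P(a|b|cy)+P(acy|b)+P(a|bcy)] + P(a|bcy)·[P(ac|b|y)+P(ay|b|c)] ≤ [P(ab|cy)+P(abcy)]·P(a|b|c|y)`.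
Pure finite combinatorics + the existing two-copy bridge; no named facts, no sorries, standard axioms.
-/

namespace Summit.CriticalPhenomena.PercolationContinuityZ3.Theorems

namespace TwoCopyMono

open Finset FourPointAtoms

/-- **Nine-type kernels avoiding types 1, 2 are good** (all of `{3,…,9}`, clash included). [this work] -/
theorem goodKernel_kerS_no12 (S : Finset ℕ) (hS : ∀ θ ∈ S, 1 ≤ θ ∧ θ ≤ 9)
    (hno : ∀ θ ∈ S, θ ≠ 1 ∧ θ ≠ 2) : GoodKernel (kerS S) := by
  classical
  rw [goodKernel_kerS_iff_cellCount]
  intro γ _ _ ι hmono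
  set 𝒯 : Finset (Finset γ) := Finset.univ.filter (fun T => badS S (ι T) (ι Tᶜ)) with h𝒯
  set 𝔊 : Finset (Finset γ) := Finset.univ.filter (fun T => isAC (ι T) ∧ ι Tᶜ = 0) with h𝔊
  have h𝔊mem : ∀ T, T ∈ 𝔊 ↔ isAC (ι T) ∧ ι Tᶜ = 0 := by
    intro T; rw [h𝔊, Finset.mem_filter]; simp
  obtain ⟨θf, hθS, hθ9, hθh, hθl⟩ := exists_typeFun S hS ι 𝒯
    (fun T hT => by rw [h𝒯, Finset.mem_filter] at hT; exact hT.2)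
  have hθ : ∀ t ∈ 𝒯, 1 ≤ θf t ∧ θf t ≤ 9 := fun t ht => hS _ (hθS t ht)
  have hcont := cellMap_cont ι hmono 𝒯 θf hθ9 hθh hθl
  have hcov' := cellMap_union_ne_univ ι hmono 𝒯 θf hθ9 hθh hθl
  have hcov : ∀ s ∈ 𝒯, ∀ s' ∈ 𝒯, s ≠ s' → s ∪ s' ≠ Finset.univ := fun s hs s' hs' _ => hcov' s hs s' hs'
  have hGup : IsUpperSet (𝔊 : Set (Finset γ)) := cellMap_goods_upper ι hmono 𝔊 h𝔊mem
  have hG : ∀ g ∈ 𝔊, ∀ g' : Finset γ, g ⊆ g' → g' ∈ 𝔊 := fun g hg g' hgg' => hGup hgg' hg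
  have hHL := cellMap_hl_good ι hmono 𝒯 θf 𝔊 hθ9 hθh hθl h𝔊mem
  have hHH' := cellMap_hh_good ι hmono 𝒯 θf 𝔊 hθ9 hθh hθl h𝔊mem
  have hHH : ∀ s ∈ 𝒯, ∀ s' ∈ 𝒯, s ≠ s' → NineType.hhOK (θf s) (θf s') = true → s ∪ s' ∈ 𝔊 :=
    fun s hs s' hs' _ hok => hHH' s hs s' hs' hok
  have hno' : ∀ s ∈ 𝒯, θf s ≠ 1 ∧ θf s ≠ 2 := fun s hs => hno _ (hθS s hs)
  exact NineType.card_le_of_no_12 𝒯 θf hθ hcont hcov 𝔊 hG hHL hHH hno'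

/-! ## Law level -/

variable {n : ℕ}

/-- **Packing without types 1, 2** for every `S ⊆ {3,…,9}`, every finite weighted graph and all marked points:
`Σ_{θ ∈ S} cell(h θ)·cell(l θ) ≤ (cell(ab|cy) + cell(abcy))·cell(a|b|c|y)`. [this work] -/
theorem q44b_pack_of_no12 (S : Finset ℕ) (hS : ∀ θ ∈ S, 1 ≤ θ ∧ θ ≤ 9)
    (hno : ∀ θ ∈ S, θ ≠ 1 ∧ θ ≠ 2)
    (w : Sym2 (Fin n) → unitInterval) (a b c y : Fin n) :
    ∑ θ ∈ S, cell w a b c y (hIdx θ) * cell w a b c y (lIdx θ) ≤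
      (cell w a b c y 11 + cell w a b c y 14) * cell w a b c y 0 := by
  have h := sum_kernel_cell_nonneg (goodKernel_kerS_no12 S hS hno) w a b c y
  rw [sum_kerS_cell S hS] at h
  linarith

/-- **`Q44b` without the two AC-light types 1, 2, for every finite weighted graph (all `n`):**
`P(ab|c|y)·[P(ac|by)+P(ay|bc)+P(a|b|cy)+P(acy|b)+P(a|bcy)] + P(a|bcy)·[P(ac|b|y)+P(ay|b|c)] ≤ [P(ab|cy)+P(abcy)]·P(a|b|c|y)` —
seven of the nine products of `Q44b` under one budget (supersedes `q44b_pack_no126` and the three-copy `T₂ + T₃`). [this work] -/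
theorem q44b_pack_no12 (w : Sym2 (Fin n) → unitInterval) (a b c y : Fin n) :
    cell w a b c y 6 * (cell w a b c y 9 + cell w a b c y 8 + cell w a b c y 1 + cell w a b c y 10 +
        cell w a b c y 7) +
      cell w a b c y 7 * (cell w a b c y 5 + cell w a b c y 4) ≤
      (cell w a b c y 11 + cell w a b c y 14) * cell w a b c y 0 := by
  have h := q44b_pack_of_no12 ({3, 4, 5, 6, 7, 8, 9} : Finset ℕ) (by decide) (by decide) w a b c y
  have he : (∑ θ ∈ ({3, 4, 5, 6, 7, 8, 9} : Finset ℕ),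
      cell w a b c y (hIdx θ) * cell w a b c y (lIdx θ)) =
      cell w a b c y 6 * (cell w a b c y 9 + cell w a b c y 8 + cell w a b c y 1 + cell w a b c y 10 +
        cell w a b c y 7) +
      cell w a b c y 7 * (cell w a b c y 5 + cell w a b c y 4) := by
    rw [Finset.sum_insert (by decide), Finset.sum_insert (by decide), Finset.sum_insert (by decide),
      Finset.sum_insert (by decide), Finset.sum_insert (by decide), Finset.sum_insert (by decide),
      Finset.sum_singleton]
    simp only [hIdx, lIdx]
    norm_num
    ring
  linarith

end TwoCopyMono

end Summit.CriticalPhenomena.PercolationContinuityZ3.Theorems
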